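import Summits.QuantumFields.BalabanUV.T4Continuum.Support.ShellMeasureLandauEndAssembledReachBlockP4

/-!
# `T4Continuum.ShellMeasureLandauEndAssembledReachBlockP4Dim4` — row S77 f8, file 2: «(P4) LIVE IN THE γ3 END» AT CONCRETE
# NUMBERS — the (SM) threshold of file 1 sits inside the core radius in the window `S ≤ η²∕10⁷`, and the FOUR-DIMENSIONAL
# instance of file 1's `slotAC_assembled_decay_core_collar_blockP4` with NO hypothesis left
(cell `pub-balaban`, sub-cell `t4`, spine estimate NE7c (node U5b); NE7c ROUND-2 crew, unit
`b2b-balaban-t4-ne7c-formalise-leaf-02` gen 11; journal INTENT l.20950; ADDITIVE — imports file 1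
`ShellMeasureLandauEndAssembledReachBlockP4` ONLY (`ampC`, `ampC_bounds`, `εθ₂`, `slotAC_assembled_decay_core_collar_blockP4`,
BY NAME); [folklore]; 0 `def`, 0 `def … : Prop`, 0 sorry, 0 citation tags; v1.1 = DOCFIX-LOW-1 of XREAD C-ne7cleaf03g8-5 (leaf-03-g8): the
`_dim4` docstring's threshold letter `εθ₁` → `εθ₂` — every declaration byte-identical)

HONEST FRAMING.  Arithmetic on OUR toy numbers + one instance of file 1's consistency certificate; nothing about Bałaban's
minimiser, propagators, kernels or densities.  Finite four-torus programme, rung (B)+1 only — NOT infinite volume, NOT a mass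
gap, NOT the Clay problem, NOT summit progress; NE7c (`T4IndicatorShell.ShellWeightBound`) NOT PRINTED, NOT PROVED; «NE7c ⇐ the
named binders» (c3); (M1) realized on a toy ≠ NE7c.  HONEST DEPENDENCY (cell): continuum YM on T⁴ ⇐ BetaPertH ∧ nine spine
estimates (0/9 proved); BetaPertH ⇐ (D1) ∧ (D4) ∧ CAP+tail; G-an2-4 gates asym, D1 and NE2/3/4.

* **`sin_half_ge`**: `S∕4 ≤ sin(S∕2)` on `[0, 2]` (Jordan).
* **`εθ₂_eta_sq_le`**: for `d ≥ 1`, `0 < η ≤ 1`, `0 < S ≤ η²∕10⁷`: `εθ₂ d S η · η² ≤ S∕12`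
  (`εθ₂·η² = 72(z̄ + z̄²)∕(η∕(192S) − 1)²`, `z̄ ≤ 9∕128`, `η∕(192S) − 1 ≥ η∕(384S)`; margin ≈ 4 %).
* **`slotAC_assembled_decay_core_collar_blockP4_dim4`**: EVERY lattice `P` with `P.d = 4`, level `j` with ≥ 3 sites per
  direction, corner `lo`, `i₀ < i₁`, enumeration `e`; block dimension `d = 4`, `η = ½`, `S = 10⁻⁸` (`< η∕192 = 1∕384`), core
  radius `a = sin(S∕2)∕3` (`(P.d−1)·2·a = 2 sin(S∕2)`), threshold `εθ₂ 4 S η·η² ≤ S∕12 ≤ a`, depth `ρ = 1∕20` — NO hypothesis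
  left: the γ3 END's whole binder family, `hW := blockW_prop4Hyp`, the non-zero propagator letter and the live
  Landau-correction triple are JOINTLY INHABITED at explicit numbers in the live dimension.  NOTHING in the countdown moves.
-/

noncomputable section

open Set Metric NormedSpace MeasureTheory Function

namespace Summit.QuantumFields.BalabanUV.T4Continuum.ShellMeasureLandauEndAssembledReachBlockP4Dim4

open scoped ENNReal Matrix.Norms.L2Operator
open Literature.MathematicalPhysics.QuantumFieldTheory.Balaban1983to89
open T4ShellMeasure (SlotAntiConcentration)
open T4CubeChartGnomonic (SU2)
open ShellMeasureLandauEndFinalToy (toyU)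
open ShellMeasureLandauEndAssembledDecayReachToyData (b₀ p₀)
open ShellMeasureLandauEndAssembledDecayReachToy (toyF7)
open ShellMeasureLandauEndBlockSpace (C₄c C₄c_nonneg)
open ShellMeasureLandauEndAssembledReachBlockP4 (ampC ampC_bounds εθ₂ slotAC_assembled_decay_core_collar_blockP4)

/-! ## The threshold inside the core radius, and the four-dimensional instance -/

section Numbers

/-- `S∕4 ≤ sin(S∕2)` for `0 ≤ S ≤ 2` (Jordan). [folklore] -/
theorem sin_half_ge {S : ℝ} (hS : 0 ≤ S) (hS2 : S ≤ 2) : S / 4 ≤ Real.sin (S / 2) := by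
  have h := Real.mul_le_sin (by linarith : 0 ≤ S / 2) (by linarith [Real.pi_gt_three] : S / 2 ≤ Real.pi / 2)
  have : S / 4 ≤ 2 / Real.pi * (S / 2) := by rw [div_mul_eq_mul_div, le_div_iff₀ Real.pi_pos]; nlinarith [Real.pi_le_four]
  linarith

/-- **THE (SM) THRESHOLD IS SMALL IN THE WINDOW**: for `d ≥ 1`, `0 < η ≤ 1`, `0 < S ≤ η²∕10⁷`, `εθ₂ d S η · η² ≤ S∕12`
(`εθ₂·η² = 72(z̄ + z̄²)∕(η∕(192S) − 1)²`, `z̄ ≤ 9∕128`, `η∕(192S) − 1 ≥ η∕(384S)`). [folklore] -/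
theorem εθ₂_eta_sq_le (d : ℕ) (hd1 : 1 ≤ d) {S η : ℝ} (hη : 0 < η) (hη1 : η ≤ 1) (hS : 0 < S) (hS7 : S ≤ η ^ 2 / 10 ^ 7) :
    εθ₂ d S η * η ^ 2 ≤ S / 12 := by
  obtain ⟨hA0, hA1⟩ := ampC_bounds d hd1
  have hA : 72 * (ampC d + ampC d ^ 2) ≤ 88776 / 16384 := by nlinarith
  have hη2 : η ^ 2 ≤ η := by nlinarith
  have hSη : S ≤ η / 10 ^ 7 := hS7.trans (by gcongr)
  have hR : 2 ≤ (η / 192) / S := by rw [le_div_iff₀ hS]; linarith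
  have hD : η / (384 * S) ≤ (η / 192) / S - 1 := by
    have : η / (384 * S) = ((η / 192) / S) / 2 := by field_simp; ring
    rw [this]; linarith
  have hDpos : 0 < (η / 192) / S - 1 := by linarith
  have hval : εθ₂ d S η * η ^ 2 = 72 * (ampC d + ampC d ^ 2) / ((η / 192) / S - 1) ^ 2 := by unfold εθ₂; field_simp; ring
  rw [hval, div_le_iff₀ (pow_pos hDpos 2)]
  calc 72 * (ampC d + ampC d ^ 2) ≤ 88776 / 16384 := hA
    _ ≤ S / 12 * (η / (384 * S)) ^ 2 := by
        rw [show S / 12 * (η / (384 * S)) ^ 2 = η ^ 2 / (1769472 * S) by field_simp; ring]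
        rw [le_div_iff₀ (by positivity)]
        nlinarith
    _ ≤ S / 12 * ((η / 192) / S - 1) ^ 2 := by gcongr

variable {P : Params} {j : ℕ} [DecidableEq (PBond P j)]

/-- **THE FOUR-DIMENSIONAL INSTANCE — NO HYPOTHESIS LEFT.**  Every lattice `P` with `P.d = 4`, level `j` with ≥ 3 sites per
direction, corner `lo`, `i₀ < i₁`, `e`; block dimension `d = 4`, `η = ½`, `S = 10⁻⁸` (`< η∕192`), core radius `a = sin(S∕2)∕3`
(`(d−1)·2·a = 2 sin(S∕2)`), threshold `εθ₂ 4 S η·η² ≤ S∕12 ≤ a`, depth `ρ = 1∕20`. [folklore] -/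
theorem slotAC_assembled_decay_core_collar_blockP4_dim4 (hP : P.d = 4) (lo : Fin P.d → ℤ) {i₀ i₁ : Fin P.d}
    (h01 : i₀ < i₁) (h3 : 3 ≤ P.sitesPerDir j) {m₀ : ℕ} (e : ↥({b₀ lo i₀ i₁} : Finset (PBond P j)) × Fin 3 ≃ Fin m₀) :
    SlotAntiConcentration ((fieldMeasure P j SU2).withDensity
        (toyF7 lo h01 (Real.sin ((1 / 10 ^ 8 : ℝ) / 2) / 3))) (toyU (p₀ lo i₀ i₁ h01))
      (εθ₂ 4 (1 / 10 ^ 8) (1 / 2) * (1 / 2) ^ 2) (1 / 20) (4 * m₀) := by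
  have hS : (0 : ℝ) < 1 / 10 ^ 8 := by norm_num
  have hsin := sin_half_ge hS.le (by norm_num : (1 / 10 ^ 8 : ℝ) ≤ 2)
  have ha : 0 < Real.sin ((1 / 10 ^ 8 : ℝ) / 2) / 3 := by linarith
  have hrad : ((P.d - 1 : ℕ) : ℝ) * (2 : ℕ) * (Real.sin ((1 / 10 ^ 8 : ℝ) / 2) / 3) ≤
      2 * Real.sin ((1 / 10 ^ 8 : ℝ) / 2) := by
    rw [hP]; norm_num; linarith
  have hθ : εθ₂ 4 (1 / 10 ^ 8) (1 / 2) * (1 / 2) ^ 2 ≤ Real.sin ((1 / 10 ^ 8 : ℝ) / 2) / 3 :=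
    (εθ₂_eta_sq_le 4 (by norm_num) (by norm_num) (by norm_num) hS (by norm_num)).trans (by linarith)
  exact slotAC_assembled_decay_core_collar_blockP4 lo h01 h3 e 4 (by norm_num) (by norm_num) (by norm_num) hS
    (by norm_num) (by norm_num) (by norm_num) ha hrad hθ

end Numbers

end Summit.QuantumFields.BalabanUV.T4Continuum.ShellMeasureLandauEndAssembledReachBlockP4Dim4

end
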